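import Mathlib
import HarnessLib
import Literature.AlgebraicGeometry.Resolution.RegularSystemOfParameters
import Literature.AlgebraicGeometry.Resolution.RegularLocalRingsNormal
import Summits.ResolutionOfSingularities.ResolutionOfSingularities.Theorems.HomologicalConductorNoZenoOrdValuation
import Summits.ResolutionOfSingularities.ResolutionOfSingularities.Theorems.SyzygyFlatteningHigherRankTerminationLocAt

/-!
# Route `HomologicalConductor`, crux `NoZeno`/`NoZenoR` (stmt-ResolutionOfSingularities-16483 / -19943),
# line `sandwich-cluster`: the order valuation of a 2-dimensional regular local ring is a PRIME DIVISOR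

OURS (cell res-hironaka, crux chain W4.4, seat res-L0-w44-stub-3). Nothing here is a statement of the
manuscript under review (Hironaka 2017); AI-written, weaker than expert review.

Second companion of `HomologicalConductorNoZenoOrdValuation.lean` (`ordSet S` is a valuation subring
`V` of `K` for `S` regular local, `Frac S = K`).  Here: if `dim S = 2` then `V` is RESIDUALLY
TRANSCENDENTAL over `k` — for a regular system of parameters `𝔪_S = (x₀, x₁)` the element
`z = x₁/x₀ ∈ V` has `v(f(z)) = 1` for every non-zero `f ∈ k[X]` (its residue is transcendental over
`k`): `x₀ⁿ · f(x₁/x₀)` is a binary form of degree `n = deg f` in `x₀, x₁` with a unit coefficient, hence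
of order exactly `n` (initial forms in a regular local ring: `gr_𝔪 S = κ[X₀, X₁]`, tree lemma
`map_residue_eq_zero_of_eval_mem_pow_succ`, Matsumura 17.10), equal to `ord x₀ⁿ`.  So the dictionary's
`E_q` (CRUX-PLAN W4.4 v2 §2) is a prime divisor of `K/k` in Zariski's sense and is NEVER
zero-dimensional — in particular never the tower's valuation ring `O` of the kernel case, whose
zero-dimensionality clause `∀ y ∈ O, ∃ f ≠ 0, v_O(f(y)) < 1` is negated verbatim below.

* `isHomogeneous_binForm`, `eval_binForm`, `coeff_binForm_top` — bookkeeping for the binary form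
  `Σ_{i ≤ n} c_i X₁^i X₀^(n-i)` (written out as a `Finset` sum of monomials; no definition introduced);
* `residue_algebraMap_ne_zero` — `k → S → S/𝔪_S` is injective;
* `adicOrder_eval_binForm` — **forms of degree `n` in a regular system of parameters with a non-zero
  coefficient from `k` have order exactly `n`**; `adicOrder_rsop` — parameters have order `1`;
* (units: `SyzygyFlattening.valuation_eq_one_of_inv_mem`, imported);
* **`exists_forall_valuation_aeval_eq_one`** — `dim S = 2`, `↑V = ordSet S` ⇒
  `∃ z ∈ V, ∀ f ≠ 0, V.valuation (aeval z f) = 1`; `not_zeroDimensional_of_coe_eq_ordSet` — the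
  negation of the crux's zero-dimensionality clause for `V`; `…_of_mem_basePts` — the `basePts` form.

Not here: the residue field of `V` is EXACTLY `κ(S)(z̄)` (purely transcendental of degree one;
Zariski–Samuel VIII §1 Cor.) — only "transcendence degree ≥ 1" is proved, which is what separates
prime divisors from zero-dimensional valuations.

References: O. Zariski, P. Samuel, *Commutative Algebra* II (1960), Ch. VIII §1, Thm. 1 and Corollary
[`ZariskiSamuel1960`]; H. Matsumura, *Commutative Ring Theory*, Thm. 17.10 [`Matsumura1987`].
-/

noncomputable section

-- single-problem summit: the doubled namespace component `ResolutionOfSingularities` is forced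
set_option linter.dupNamespace false

namespace Summit.ResolutionOfSingularities.ResolutionOfSingularities.Theorems.NoZeno.SandwichCluster

open IsLocalRing Literature.AlgebraicGeometry.Resolution MvPolynomial
open Summit.ResolutionOfSingularities.ResolutionOfSingularities.Theorems

variable {k K : Type} [Field k] [Field K] [Algebra k K]

section Forms

variable {S : Subalgebra k K} [IsRegularLocalRing ↥S]
variable {d : ℕ} (hd : (maximalIdeal ↥S).spanFinrank = d) (x : Fin d → ↥S)
  (hx : Ideal.span (Set.range x) = maximalIdeal ↥S)

omit [IsRegularLocalRing ↥S] in
/-- `binForm` is homogeneous of degree `n`. [folklore] -/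
theorem isHomogeneous_binForm (i₀ i₁ : Fin d) (f : Polynomial k) (n : ℕ) :
    (∑ i ∈ Finset.range (n + 1), monomial (Finsupp.single i₁ i + Finsupp.single i₀ (n - i))
      (algebraMap k ↥S (f.coeff i))).IsHomogeneous n := by
  refine IsHomogeneous.sum _ _ _ fun i hi => ?_
  have hi' : i ≤ n := Nat.lt_succ_iff.mp (Finset.mem_range.mp hi)
  apply isHomogeneous_monomial
  rw [map_add, Finsupp.degree_single, Finsupp.degree_single]
  omega

omit [IsRegularLocalRing ↥S] in
/-- The value of `binForm` at `x`. [folklore] -/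
theorem eval_binForm (i₀ i₁ : Fin d) (f : Polynomial k) (n : ℕ) :
    eval x (∑ i ∈ Finset.range (n + 1), monomial (Finsupp.single i₁ i + Finsupp.single i₀ (n - i))
      (algebraMap k ↥S (f.coeff i))) =
      ∑ i ∈ Finset.range (n + 1), algebraMap k ↥S (f.coeff i) * x i₁ ^ i * x i₀ ^ (n - i) := by
  rw [map_sum]
  refine Finset.sum_congr rfl fun i _ => ?_
  rw [eval_monomial, Finsupp.prod_add_index', Finsupp.prod_single_index, Finsupp.prod_single_index]
  · ring
  · exact pow_zero _
  · exact pow_zero _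
  · intro j; exact pow_zero _
  · intro j a b; exact pow_add _ _ _

omit [IsRegularLocalRing ↥S] in
/-- The coefficient of `X₁^n` in `binForm` is the image of the `n`-th coefficient of `f`. [folklore] -/
theorem coeff_binForm_top (i₀ i₁ : Fin d) (hne : i₀ ≠ i₁) (f : Polynomial k) (n : ℕ) :
    coeff (Finsupp.single i₁ n) (∑ i ∈ Finset.range (n + 1),
      monomial (Finsupp.single i₁ i + Finsupp.single i₀ (n - i)) (algebraMap k ↥S (f.coeff i))) =
      algebraMap k ↥S (f.coeff n) := by
  rw [coeff_sum]
  rw [Finset.sum_eq_single n]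
  · simp
  · intro i hi hin
    rw [coeff_monomial, if_neg]
    intro h
    have h1 : (Finsupp.single i₁ i + Finsupp.single i₀ (n - i)) i₀ = n - i := by
      simp [Ne.symm hne]
    have h2 : (Finsupp.single i₁ n : Fin d →₀ ℕ) i₀ = 0 := by
      simp [Ne.symm hne]
    rw [h, h2] at h1
    have hi' : i ≤ n := Nat.lt_succ_iff.mp (Finset.mem_range.mp hi)
    omega
  · intro h
    exact absurd (Finset.self_mem_range_succ n) h

/-- The residue map `k → S → S/𝔪_S` is injective (`k` a field, `S/𝔪_S ≠ 0`). [folklore] -/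
theorem residue_algebraMap_ne_zero {c : k} (hc : c ≠ 0) :
    residue ↥S (algebraMap k ↥S c) ≠ 0 := by
  have : Function.Injective ((residue ↥S).comp (algebraMap k ↥S)) := RingHom.injective _
  intro h
  apply hc
  apply this
  rw [RingHom.comp_apply, h, map_zero]

include hd hx in
/-- **Binary forms in a regular system of parameters have the expected order**: for `f ≠ 0` of
degree `n`, `ord (Σ c_i x₁^i x₀^(n-i)) = n`. [cite: ZariskiSamuel1960, Ch. VIII §1 Thm. 1] -/
theorem adicOrder_eval_binForm (i₀ i₁ : Fin d) (hne : i₀ ≠ i₁) {f : Polynomial k} (hf : f ≠ 0) :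
    adicOrder (eval x (∑ i ∈ Finset.range (f.natDegree + 1),
      monomial (Finsupp.single i₁ i + Finsupp.single i₀ (f.natDegree - i))
        (algebraMap k ↥S (f.coeff i)))) = f.natDegree := by
  set n := f.natDegree
  have hF := isHomogeneous_binForm (S := S) i₀ i₁ f n
  refine le_antisymm ?_ ?_
  · -- not in `𝔪^(n+1)`: the reduction of the form is non-zero
    rw [adicOrder_le_iff]
    intro hmem
    have h0 := map_residue_eq_zero_of_eval_mem_pow_succ hd x hx hF hmem
    have := congrArg (coeff (Finsupp.single i₁ n)) h0
    rw [coeff_map, coeff_binForm_top i₀ i₁ hne, coeff_zero] at this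
    exact residue_algebraMap_ne_zero (Polynomial.leadingCoeff_ne_zero.mpr hf) this
  · rw [le_adicOrder_iff, ← hx]
    exact eval_mem_span_pow x hF

include hd hx in
/-- A member of a regular system of parameters has order one. [folklore] -/
theorem adicOrder_rsop (i : Fin d) : adicOrder (x i) = 1 := by
  have hF : (X i : MvPolynomial (Fin d) ↥S).IsHomogeneous 1 := isHomogeneous_X _ _
  refine le_antisymm ?_ ?_
  · have h := (adicOrder_le_iff (x i) 1)
    rw [Nat.cast_one] at h
    rw [h]
    intro hmem
    have h0 := map_residue_eq_zero_of_eval_mem_pow_succ hd x hx hF (by rwa [eval_X])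
    rw [map_X] at h0
    exact (X_ne_zero _ ) h0
  · have h := le_adicOrder_iff (x i) 1
    rw [Nat.cast_one, pow_one] at h
    exact h.mpr (hx ▸ Ideal.subset_span ⟨i, rfl⟩)

end Forms

section Residue

variable {S : Subalgebra k K} [IsRegularLocalRing ↥S]

/-- **The order valuation of a two-dimensional regular local ring is residually transcendental**
(a PRIME DIVISOR, never zero-dimensional): for a regular system of parameters `𝔪_S = (x, y)` the
element `z = y/x` of `V` (`↑V = ordSet S`) satisfies `v(f(z)) = 1` for every non-zero `f ∈ k[X]` —
its residue is transcendental over `k` (`x^n f(y/x)` is a binary form of degree `n = deg f` in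
`x, y` with a unit coefficient, hence of order exactly `n = ord xⁿ`).
[cite: ZariskiSamuel1960, Ch. VIII §1 Thm. 1 and Corollary] -/
theorem exists_forall_valuation_aeval_eq_one (hdim : ringKrullDim ↥S = 2) (V : ValuationSubring K)
    (hV : (V : Set K) = ordSet S) :
    ∃ z : K, z ∈ V ∧ ∀ f : Polynomial k, f ≠ 0 → V.valuation (Polynomial.aeval z f) = 1 := by
  haveI := isDomain_of_isRegularLocalRing (↥S)
  have memV : ∀ {w : K}, w ∈ V ↔ w ∈ ordSet S := fun {w} => by rw [← SetLike.mem_coe, hV]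
  obtain ⟨x, hx⟩ := exists_regularSystemOfParameters (R := ↥S)
  generalize hd : (maximalIdeal ↥S).spanFinrank = d at x hx
  have hd2 : d = 2 := by
    have h := IsRegularLocalRing.spanFinrank_maximalIdeal (R := ↥S)
    rw [hdim, hd] at h
    exact_mod_cast h
  subst hd2
  set i₀ : Fin 2 := 0
  set i₁ : Fin 2 := 1
  have hne : i₀ ≠ i₁ := by decide
  have hx0 : x i₀ ≠ 0 := fun h => by
    have := adicOrder_rsop hd x hx i₀
    rw [h, adicOrder_zero] at this
    exact ENat.top_ne_coe 1 (by exact_mod_cast this)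
  have hx0K : (x i₀ : K) ≠ 0 := fun h => hx0 (by exact_mod_cast h)
  refine ⟨(x i₁ : K) / (x i₀ : K), ?_, ?_⟩
  · rw [memV, div_eq_mul_inv, coe_mul_inv_mem_ordSet_iff S _ _ hx0, adicOrder_rsop hd x hx i₀,
      adicOrder_rsop hd x hx i₁]
  · intro f hf
    set n := f.natDegree with hn
    set E : ↥S := eval x (∑ i ∈ Finset.range (n + 1),
      monomial (Finsupp.single i₁ i + Finsupp.single i₀ (n - i)) (algebraMap k ↥S (f.coeff i)))
      with hE
    have hordE : adicOrder E = n := adicOrder_eval_binForm hd x hx i₀ i₁ hne hf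
    have hE0 : E ≠ 0 := fun h => by
      rw [h, adicOrder_zero] at hordE
      exact ENat.top_ne_coe n hordE
    have hEK : (E : K) ≠ 0 := fun h => hE0 (by exact_mod_cast h)
    have hordpow : adicOrder (x i₀ ^ n) = n := by
      rw [adicOrder_pow, adicOrder_rsop hd x hx i₀, mul_one]
    have hpow0 : x i₀ ^ n ≠ 0 := pow_ne_zero _ hx0
    -- the key identity `x₀ⁿ · f(y/x₀) = E`
    have key : (x i₀ : K) ^ n * Polynomial.aeval ((x i₁ : K) / (x i₀ : K)) f = (E : K) := by
      rw [Polynomial.aeval_eq_sum_range, Finset.mul_sum, hE, eval_binForm, AddSubmonoidClass.coe_finsetSum]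
      refine Finset.sum_congr rfl fun i hi => ?_
      have hi' : i ≤ n := Nat.lt_succ_iff.mp (Finset.mem_range.mp hi)
      rw [Subalgebra.coe_mul, Subalgebra.coe_mul, Subalgebra.coe_pow, Subalgebra.coe_pow,
        Subalgebra.coe_algebraMap, Algebra.smul_def, div_pow]
      have : (x i₀ : K) ^ n = (x i₀ : K) ^ i * (x i₀ : K) ^ (n - i) := by
        rw [← pow_add, Nat.add_sub_cancel' hi']
      rw [this]
      field_simp
    have haeval : Polynomial.aeval ((x i₁ : K) / (x i₀ : K)) f = (E : K) * (((x i₀ ^ n : ↥S)) : K)⁻¹ := by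
      rw [Subalgebra.coe_pow, ← key, mul_comm, ← mul_assoc, inv_mul_cancel₀ (pow_ne_zero _ hx0K),
        one_mul]
    have hne0 : Polynomial.aeval ((x i₁ : K) / (x i₀ : K)) f ≠ 0 := by
      rw [haeval]
      exact mul_ne_zero hEK (inv_ne_zero (by exact_mod_cast hpow0))
    refine SyzygyFlattening.valuation_eq_one_of_inv_mem V ?_ ?_ hne0
    · rw [memV, haeval, coe_mul_inv_mem_ordSet_iff S _ _ hpow0, hordE, hordpow]
    · rw [memV, haeval, mul_inv, inv_inv, mul_comm, coe_mul_inv_mem_ordSet_iff S _ _ hE0, hordE,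
        hordpow]

/-- In the syntax of the crux's zero-dimensionality clause: the order valuation ring of a
two-dimensional regular local `S` is NOT zero-dimensional over `k` — some element of `V` has no
non-zero polynomial over `k` of value `< 1`.  In particular no `E_q` of the line's dictionary is the
tower's (zero-dimensional, kernel-case) valuation ring `O`. [cite: ZariskiSamuel1960, Ch. VIII §1 Thm. 1 and Corollary] -/
theorem not_zeroDimensional_of_coe_eq_ordSet (hdim : ringKrullDim ↥S = 2) (V : ValuationSubring K)
    (hV : (V : Set K) = ordSet S) :
    ¬ (∀ y : K, y ∈ V → ∃ f : Polynomial k, f ≠ 0 ∧ V.valuation (Polynomial.aeval y f) < 1) := by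
  intro h
  obtain ⟨z, hzV, hz⟩ := exists_forall_valuation_aeval_eq_one hdim V hV
  obtain ⟨f, hf, hlt⟩ := h z hzV
  rw [hz f hf] at hlt
  exact lt_irrefl _ hlt

omit [IsRegularLocalRing ↥S] in
/-- The `basePts` form: the prime divisor of a base point is residually transcendental over `k`.
[cite: ZariskiSamuel1960, Ch. VIII §1 Thm. 1 and Corollary] -/
theorem exists_forall_valuation_aeval_eq_one_of_mem_basePts {R T : Subalgebra k K}
    [IsFractionRing ↥R K] (hS : S ∈ basePts R T) (V : ValuationSubring K)
    (hV : (V : Set K) = ordSet S) :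
    ∃ z : K, z ∈ V ∧ ∀ f : Polynomial k, f ≠ 0 → V.valuation (Polynomial.aeval z f) = 1 := by
  obtain ⟨-, hreg, hdim, -, -⟩ := hS
  haveI := hreg
  exact exists_forall_valuation_aeval_eq_one hdim V hV

end Residue

end Summit.ResolutionOfSingularities.ResolutionOfSingularities.Theorems.NoZeno.SandwichCluster

end
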